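import Mathlib
import HarnessLib
import HarnessLib.Audit
import Summits.CriticalPhenomena.PercolationContinuityZ3.Theorems.PercNearOneGluingNoHeavyLowerTailHexMSMatchMS2

/-!
# (MS2) for EVERY Marica–Schönheim-tight family (hp-7 gen 73): the `hmem` hypothesis of the tight case removed

Support file for crux `stmt-CriticalPhenomena-4575` (route `PercNearOneGluingNoHeavy`), hull-port seat `prim-hp-7` (generation 73);
`--supports stmt-CriticalPhenomena-4575`.  No `sorry`.  Memo: `run/shared/lean/prim/prim-hp-7/FROM-prim-hp-7-g73-MS2-HALL.md` §1.

Gen 72 proved the second-order Marica–Schönheim inequality (MS2) (`MS2`, file `…HexMSMatchMS2`) for MS-tight families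
`F = P ⊔ Q` under the extra hypothesis `hmem : no member of F is a difference of two members` (automatic for pairwise
intersecting `F`, which is all the application needs).  Here that hypothesis is removed, so that **(MS2) holds for every
MS-tight two-coloured family**:

* `witness_notMem_diffs_of_pivot` — in a tight family with pivot `c`, if the fibre witness `(c \ x) ∪ z` (`x ⊆ c`, `z ∩ c = ∅`)
  is itself a difference of two members, then EVERY difference `d` with `c`-part `d ∩ c = x` is a member of `F`
  (`c ∆ w = x ∪ z ∈ F` by `symmDiff_mem_of_mem_diffs`, then `d = (c \ (c \ x)) ∪ (d \ c) ∈ F` by `tp_mem_of_pivot`).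
* `card_le_card_filter_secondDiff_notMem_of_pivot` — the tight core `card_le_card_filter_secondDiff_of_pivot` with the
  witnesses additionally OUTSIDE `F \\ F`, for designated differences that are not members (same fibre argument:
  Marica–Schönheim on each fibre of `D` over its `c`-part, witnesses `(c \ x) ∪ z`).
* `card_le_card_secondDiff_of_tight'` — **(MS2) for every MS-tight `F = P ∪ Q`**: `D₅ ⊆ P \\ Q`, `D₂ ⊆ Q \\ P` pure
  (`∉ P \\ P ∪ Q \\ Q`), `#(F \\ F) = #F` ⟹ `#(F ∪ D₅ ∪ D₂) ≤ #(F \\ F ∪ P \\ D₅ ∪ Q \\ D₂)`.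

So the open part of (MS2) is exactly the MS-excess range `1 ≤ #(F \\ F) − #F < #(D \ F)` (memo §0).
-/

namespace Summit.CriticalPhenomena.PercolationContinuityZ3.Theorems

namespace GeneratedDonors

open Finset FinsetFamily

variable {α : Type*} [DecidableEq α]

section TightAll

variable {F P Q : Finset (Finset α)} {c : Finset α}

/-- In a tight family with pivot `c`: if the fibre witness `w = (c \ x) ∪ z` (`x ⊆ c`, `Disjoint z c`) is a difference of two
members, then every difference `d ∈ F \\ F` with `d ∩ c = x` is a member of `F`. -/
theorem witness_notMem_diffs_of_pivot (hcard : #(F \\ F) ≤ #F) (hc : ∀ g ∈ F, c ∪ g ∈ F ∧ c ∩ g ∈ F)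
    {x z d : Finset α} (hx : x ⊆ c) (hz : Disjoint z c) (hd : d ∈ F \\ F) (hdx : d ∩ c = x)
    (hw : (c \ x) ∪ z ∈ F \\ F) : d ∈ F := by
  -- `c ∆ w = x ∪ z` is a member
  have hm := symmDiff_mem_of_mem_diffs hcard hc hw
  have hxz : symmDiff c ((c \ x) ∪ z) = x ∪ z := by
    ext i
    simp only [mem_symmDiff, mem_union, mem_sdiff]
    have hzi : i ∈ z → i ∉ c := fun hiz hic => (Finset.disjoint_left.mp hz) hiz hic
    have hxi : i ∈ x → i ∈ c := fun hix => hx hix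
    tauto
  rw [hxz] at hm
  -- `e₁ = c \ (x ∪ z) = c \ x` comes from the member `x ∪ z`; `e₂ = d \ c` from the difference `d`
  have he₁ : c \ (x ∪ z) ∈ F.image (c \ ·) := mem_image.mpr ⟨x ∪ z, hm, rfl⟩
  obtain ⟨-, he₂⟩ := mem_diffs_pivot_split hcard hc hd
  have htp := tp_mem_of_pivot hcard hc _ he₁ _ he₂
  have heq : (c \ (c \ (x ∪ z))) ∪ (d \ c) = d := by
    ext i
    simp only [mem_union, mem_sdiff]
    have hzi : i ∈ z → i ∉ c := fun hiz hic => (Finset.disjoint_left.mp hz) hiz hic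
    have hxi : i ∈ x → i ∈ c := fun hix => hx hix
    have hdi : i ∈ d → i ∈ c → i ∈ x := fun hid hic => by rw [← hdx]; exact mem_inter.mpr ⟨hid, hic⟩
    have hxd : i ∈ x → i ∈ d := fun hix => by
      have : i ∈ d ∩ c := by rw [hdx]; exact hix
      exact (mem_inter.mp this).1
    tauto
  rw [heq] at htp
  exact htp

/-- **The tight core with witnesses outside `F \\ F`.**  As `card_le_card_filter_secondDiff_of_pivot`, for designated pure cross
differences that are NOT members: at least `#D` members of `F` are double second differences `p \ d = q \ d` (`d ∈ D`) and are
not themselves differences of two members. -/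
theorem card_le_card_filter_secondDiff_notMem_of_pivot (hF : F = P ∪ Q) (hcard : #(F \\ F) ≤ #F)
    (hc : ∀ g ∈ F, c ∪ g ∈ F ∧ c ∩ g ∈ F) (hcF : c ∈ F) {D : Finset (Finset α)} (hD : D ⊆ F \\ F)
    (hDF : ∀ d ∈ D, d ∉ F) (hDP : ∀ d ∈ D, d ∉ P \\ P) (hDQ : ∀ d ∈ D, d ∉ Q \\ Q) :
    #D ≤ #(F.filter fun m => m ∉ F \\ F ∧ ∃ d ∈ D, (∃ p ∈ P, p \ d = m) ∧ (∃ q ∈ Q, q \ d = m)) := by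
  classical
  set Tm := F.filter fun m => m ∉ F \\ F ∧ ∃ d ∈ D, (∃ p ∈ P, p \ d = m) ∧ (∃ q ∈ Q, q \ d = m) with hTmdef
  set X : Finset (Finset α) := D.image (· ∩ c) with hXdef
  let Dx : Finset α → Finset (Finset α) := fun x => D.filter fun d => d ∩ c = x
  let Yx : Finset α → Finset (Finset α) := fun x => (Dx x).image (· \ c)
  let Wx : Finset α → Finset (Finset α) := fun x => (Yx x \\ Yx x).image fun z => (c \ x) ∪ z
  have h1 : #D = ∑ x ∈ X, #(Dx x) := card_eq_sum_card_image (· ∩ c) D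
  have h2 : ∀ x ∈ X, #(Dx x) = #(Yx x) := by
    intro x _
    refine (card_image_of_injOn ?_).symm
    intro d hd d₂ hd₂ hdd
    have hd1 := (mem_filter.mp (mem_coe.mp hd)).2
    have hd2 := (mem_filter.mp (mem_coe.mp hd₂)).2
    have e1 : d = (d ∩ c) ∪ (d \ c) := by ext i; simp only [mem_union, mem_inter, mem_sdiff]; tauto
    have e2 : d₂ = (d₂ ∩ c) ∪ (d₂ \ c) := by ext i; simp only [mem_union, mem_inter, mem_sdiff]; tauto
    rw [e1, e2, hd1, hd2]
    simp only at hdd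
    rw [hdd]
  have hYdisj : ∀ x, ∀ z ∈ Yx x \\ Yx x, Disjoint z c := by
    intro x z hz
    obtain ⟨a, ha, b, -, rfl⟩ := mem_diffs.mp hz
    obtain ⟨d, -, rfl⟩ := mem_image.mp ha
    exact disjoint_of_subset_left sdiff_subset disjoint_sdiff_self_left
  have h3 : ∀ x ∈ X, #(Yx x) ≤ #(Wx x) := by
    intro x _
    have hinj : Set.InjOn (fun z => (c \ x) ∪ z) ↑(Yx x \\ Yx x) := by
      intro z hz z₂ hz₂ hzz
      have dz := hYdisj x z (mem_coe.mp hz)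
      have dz₂ := hYdisj x z₂ (mem_coe.mp hz₂)
      simp only at hzz
      have k1 : ((c \ x) ∪ z) \ c = z := by
        ext i; simp only [mem_sdiff, mem_union]
        constructor
        · rintro ⟨h | h, hic⟩
          · exact absurd h.1 hic
          · exact h
        · intro h; exact ⟨Or.inr h, fun hic => (Finset.disjoint_left.mp dz) h hic⟩
      have k2 : ((c \ x) ∪ z₂) \ c = z₂ := by
        ext i; simp only [mem_sdiff, mem_union]
        constructor
        · rintro ⟨h | h, hic⟩
          · exact absurd h.1 hic
          · exact h
        · intro h; exact ⟨Or.inr h, fun hic => (Finset.disjoint_left.mp dz₂) h hic⟩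
      rw [← k1, hzz, k2]
    calc #(Yx x) ≤ #(Yx x \\ Yx x) := (Yx x).card_le_card_diffs
      _ = #(Wx x) := (card_image_of_injOn hinj).symm
  -- x ⊆ c for x ∈ X
  have hXc : ∀ x ∈ X, x ⊆ c := by
    intro x hx
    obtain ⟨d, -, rfl⟩ := mem_image.mp hx
    exact inter_subset_right
  -- (4) Wx x ⊆ Tm, now including `w ∉ F \\ F`
  have h4 : ∀ x ∈ X, Wx x ⊆ Tm := by
    intro x hxX w hw
    obtain ⟨z, hz, rfl⟩ := mem_image.mp hw
    have hzc := hYdisj x z hz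
    obtain ⟨a, ha, b, hb, rfl⟩ := mem_diffs.mp hz
    obtain ⟨d', hd'x, rfl⟩ := mem_image.mp ha
    obtain ⟨d, hdx, rfl⟩ := mem_image.mp hb
    obtain ⟨hd'D, hd'c⟩ := mem_filter.mp hd'x
    obtain ⟨hdD, hdc⟩ := mem_filter.mp hdx
    have hxx : d ∩ c = d' ∩ c := hdc.trans hd'c.symm
    obtain ⟨hmF, hmeq⟩ := union_sdiff_mem_of_pivot hcard hc (hD hdD) (hD hd'D) hxx
    have hw_eq : (c \ x) ∪ ((d' \ c) \ (d \ c)) = (c ∪ d') \ d := by rw [hmeq, hdc]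
    have hnot : (c \ x) ∪ ((d' \ c) \ (d \ c)) ∉ F \\ F := fun hwd =>
      hDF d hdD (witness_notMem_diffs_of_pivot hcard hc (hXc x hxX) hzc (hD hdD) hdc hwd)
    rw [hTmdef, mem_filter]
    refine ⟨hw_eq ▸ hmF, hnot, d, hdD, ?_⟩
    rw [hw_eq]
    exact exists_sdiff_eq_witness hF hcard hc hcF (hD hdD) (hD hd'D) (hDP d hdD) (hDQ d hdD)
      (hDP d' hd'D) (hDQ d' hd'D) hxx
  have hrecover : ∀ x ∈ X, ∀ w ∈ Wx x, c \ w = x := by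
    intro x hx w hw
    obtain ⟨z, hz, rfl⟩ := mem_image.mp hw
    have dz := hYdisj x z hz
    obtain ⟨d, -, rfl⟩ := mem_image.mp hx
    ext i; simp only [mem_sdiff, mem_union, mem_inter]
    constructor
    · rintro ⟨hic, h⟩
      refine ⟨?_, hic⟩
      by_contra hid
      exact h (Or.inl ⟨hic, fun hh => hid hh.1⟩)
    · rintro ⟨hid, hic⟩
      exact ⟨hic, fun h => h.elim (fun hh => hh.2 ⟨hid, hic⟩) fun hz' => (Finset.disjoint_left.mp dz) hz' hic⟩
  have h5 : (X : Set (Finset α)).PairwiseDisjoint Wx := by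
    intro x hx x' hx' hne
    rw [Function.onFun, Finset.disjoint_left]
    intro w hw hw'
    exact hne ((hrecover x (mem_coe.mp hx) w hw).symm.trans (hrecover x' (mem_coe.mp hx') w hw'))
  calc #D = ∑ x ∈ X, #(Dx x) := h1
    _ ≤ ∑ x ∈ X, #(Wx x) := sum_le_sum fun x hx => (h2 x hx).le.trans (h3 x hx)
    _ = #(X.biUnion Wx) := (card_biUnion h5).symm
    _ ≤ #Tm := card_le_card (biUnion_subset.mpr h4)

/-- **(MS2) for every Marica–Schönheim-tight family** (the hypothesis `hmem` of `card_le_card_secondDiff_of_tight` removed):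
`F = P ∪ Q` with `#(F \\ F) = #F`, `D₅ ⊆ P \\ Q`, `D₂ ⊆ Q \\ P` pure cross differences ⟹
`#(F ∪ D₅ ∪ D₂) ≤ #(F \\ F ∪ P \\ D₅ ∪ Q \\ D₂)`. -/
theorem card_le_card_secondDiff_of_tight' (P Q D₅ D₂ : Finset (Finset α))
    (hD₅ : D₅ ⊆ P \\ Q) (hD₂ : D₂ ⊆ Q \\ P) (hpure : ∀ d ∈ D₅ ∪ D₂, d ∉ (P \\ P) ∪ (Q \\ Q))
    (htight : #((P ∪ Q) \\ (P ∪ Q)) = #(P ∪ Q)) :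
    #((P ∪ Q) ∪ D₅ ∪ D₂) ≤ #(((P ∪ Q) \\ (P ∪ Q)) ∪ (P \\ D₅) ∪ (Q \\ D₂)) := by
  classical
  set F := P ∪ Q with hFdef
  -- the designated differences that still have to be paid for: those outside F
  set D := (D₅ ∪ D₂).filter fun d => d ∉ F with hDdef
  have hDsub' : ∀ d ∈ D₅ ∪ D₂, d ∈ F \\ F := by
    intro d hd
    rcases mem_union.mp hd with hd | hd
    · obtain ⟨a, ha, b, hb, rfl⟩ := mem_diffs.mp (hD₅ hd)
      exact mem_diffs.mpr ⟨a, mem_union_left _ ha, b, mem_union_right _ hb, rfl⟩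
    · obtain ⟨a, ha, b, hb, rfl⟩ := mem_diffs.mp (hD₂ hd)
      exact mem_diffs.mpr ⟨a, mem_union_right _ ha, b, mem_union_left _ hb, rfl⟩
  have hDsub : D ⊆ F \\ F := fun d hd => hDsub' d (mem_filter.mp hd).1
  have hDF : ∀ d ∈ D, d ∉ F := fun d hd => (mem_filter.mp hd).2
  -- #(F ∪ D₅ ∪ D₂) = #F + #D
  have hsplit : (P ∪ Q) ∪ D₅ ∪ D₂ = F ∪ D := by
    ext d
    simp only [hDdef, mem_union, mem_filter, hFdef]
    tauto
  have hFD : Disjoint F D := Finset.disjoint_right.mpr fun d hd => hDF d hd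
  rw [hsplit, card_union_of_disjoint hFD]
  rcases F.eq_empty_or_nonempty with hF0 | hne
  · have hD0 : D = ∅ := by
      rw [eq_empty_iff_forall_notMem]
      intro d hd
      have := hDsub hd
      rw [hF0] at this
      simp at this
    rw [hD0, hF0]; simp
  obtain ⟨c, hcF, hc⟩ := TwistedAD.exists_pivot_of_card_diffs_eq_card F htight hne
  set Tm := F.filter fun m => m ∉ F \\ F ∧ ∃ d ∈ D, (∃ p ∈ P, p \ d = m) ∧ (∃ q ∈ Q, q \ d = m) with hTmdef
  have hcore : #D ≤ #Tm :=
    card_le_card_filter_secondDiff_notMem_of_pivot rfl htight.le hc hcF hDsub hDF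
      (fun d hd h => hpure d (mem_filter.mp hd).1 (mem_union_left _ h))
      (fun d hd h => hpure d (mem_filter.mp hd).1 (mem_union_right _ h))
  have hTmT : Tm ⊆ (P \\ D₅) ∪ (Q \\ D₂) := by
    intro m hm
    obtain ⟨-, -, d, hdD, ⟨p, hp, hpd⟩, ⟨q, hq, hqd⟩⟩ := mem_filter.mp hm
    rcases mem_union.mp (mem_filter.mp hdD).1 with hd | hd
    · exact mem_union_left _ (mem_diffs.mpr ⟨p, hp, d, hd, hpd⟩)
    · exact mem_union_right _ (mem_diffs.mpr ⟨q, hq, d, hd, hqd⟩)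
  have hdisj : Disjoint (F \\ F) Tm := by
    rw [Finset.disjoint_right]
    intro m hm
    exact (mem_filter.mp hm).2.1
  have hsub : (F \\ F) ∪ Tm ⊆ (F \\ F) ∪ (P \\ D₅) ∪ (Q \\ D₂) := by
    rw [union_assoc]; exact union_subset_union (subset_refl _) hTmT
  calc #F + #D ≤ #(F \\ F) + #Tm := Nat.add_le_add htight.ge hcore
    _ = #((F \\ F) ∪ Tm) := (card_union_of_disjoint hdisj).symm
    _ ≤ #((F \\ F) ∪ (P \\ D₅) ∪ (Q \\ D₂)) := card_le_card hsub

end TightAll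

end GeneratedDonors

end Summit.CriticalPhenomena.PercolationContinuityZ3.Theorems
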